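import Summits.HodgeConjecture.HodgeConjecture.Theorems.F0P3ClassificationKitV6          -- ★ (T5-A kit): the A3 token `F0P3InnerFormClassificationV6.splitForm` (`Φ_N`, reducible `abbrev`)
import Literature.NumberTheory.Automorphic.UnitaryGroupStdFormAutomorphicMeasure         -- ★ [Borel1963 Thm. 5.8]: `exists_isAutomorphicMeasure_cmDatum_of_isHermitian`, `isAutomorphicMeasure_unique_smul_cmDatum`, `adelicGroupData_eq_cmDatum` (rfl)
import Literature.NumberTheory.Automorphic.UnitaryGroupQuasiSplitCMDatum                 -- ★ `StdForm.over_antidiagonal_eq` (`(StdForm.antidiagonal N).over L = Matrix.of …`), `isUnit_det_antidiagonal_over`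
import HarnessLib

/-!
# R90-TF · S5 · THEOREMS — `R90S5QsAutomorphicMeasureExists`: an automorphic measure `μqs` on `U(Φ₃)(L⁺)\U(Φ₃)(𝔸_{L⁺})` EXISTS, at the A3 spelling
# (the `μqs` + `IsAutomorphicMeasure μqs` PIN of the quasi-split frame; Borel 1963, Thm. 5.8)

Cell `hodgecm-mathlib`, crux H413 (`stmt-HodgeConjecture-24833`), route of record `HCCMUnconditional`; programme R90-TF, section S5 «Ch. 13.3 multiplicity ∕
rigidity» (base `R90-C133`); dealer R90-C133-plan (g3) deal (H27) 2026-09-05T03:14:35Z → K2E5-p17 (g10).  PROOF lane (`--kind proof --supports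
stmt-HodgeConjecture-24833 --as helper`): theorems only — no `def`, no `instance`, no notation, no named fact, no `sorry`; imports ★ only (never `Cruxes/…/Lines`).

WHY.  The A3 letters of the `₃` road (`Cruxes/H413/Lines/R90_S5_ArchJLettersA3.lean`, `EvpMatch₀` ∕ (α) ∕ (β) ∕ (γ) `…At`) take the quasi-split frame as explicit ARGUMENTS,
among them an automorphic measure `μqs : Measure (adelicGroupData L⁺ L c 3 (splitForm L 3)).automorphicQuotient` with `[….IsAutomorphicMeasure μqs]` (A3 :102–:103).
The Lines-side payer of the ON-PATH socket `stub_R90_1336c_membership₃` (A :254) must EXHIBIT such a `μqs` by name.  This file pre-positions that pin: **an automorphic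
measure on `U(Φ₃)(L⁺)\U(Φ₃)(𝔸_{L⁺})` exists, stated with the measure TYPE copied token for token from A3** — `exists_isAutomorphicMeasure_qs₃` — together with its
uniqueness up to a positive scalar and the two `rfl`-bridges to the `UnitaryGroup.cmDatum` spelling (so a consumer holding the pin can feed every ★ `cmDatum`-typed theorem).

MATHEMATICS (all ★, by name).  `adelicGroupData L⁺ L c N H` IS `UnitaryGroup.cmDatum L N H` DEFINITIONALLY (★ `adelicGroupData_eq_cmDatum`, `rfl` — but not reducibly, so
typeclass search does not cross the spelling; the bridges below carry instances across with `haveI`).  For the anti-diagonal form `Φ_N = splitForm L N` (entries `0, 1`,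
pattern `i + j + 1 = N`) the two side facts of Borel's theorem hold for every `N`: `ᵗ(c Φ_N) = Φ_N` (§0 `splitForm_map_cmConjRingHom_transpose`) and `det Φ_N ≠ 0`
(§0 `splitForm_det_ne_zero`, from ★ `isUnit_det_antidiagonal_over` through ★ `StdForm.over_antidiagonal_eq : (StdForm.antidiagonal N).over L = Matrix.of …` — the literal
body of the `abbrev splitForm`).  Then ★ `exists_isAutomorphicMeasure_cmDatum_of_isHermitian L N (splitForm L N)` [Borel1963, Thm. 5.8: `G_k\G_A` has finite invariant volume
for reductive `G` without rational characters; here `G = U(Φ_N)` over `L⁺`, via the tree's orbit-count unfolding] gives the measure, and ★ `isAutomorphicMeasure_unique_smul_cmDatum`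
[Borel1963, §5] its uniqueness up to `c ∈ ℝ_{>0}`.

DEDUP NOTE (honest).  The same existence fact is ★ in the tree at two OTHER spellings: E1's `MultiplicityOneU3.exists_isAutomorphicMeasure_qs` (over `UnitaryGroup.cmDatum L 3
(qsForm L)`, `Theorems/K2E1MultiplicityOneU3DiscretePart.lean`) and S10's `R90.S10.exists_isAutomorphicMeasure_G3` (over the reducible `abbrev G3 L := adelicGroupData L⁺ L c 3
(qsForm L)`, `Theorems/R90S10Row3OfResidualCompactR.lean`); `qsForm L` and `splitForm L 3` are reducible abbreviations with the same body.  This file states the fact at the A3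
spelling in the S5 namespace with a three-module import cone (the T5-A kit for the token `splitForm`, the Literature measure file and the Literature `J_N` dictionary), for every `N` and at `N = 3`.

CONTENTS (all PROVED).  §0 `splitForm_map_cmConjRingHom_transpose`, `splitForm_transpose_map_cmConjRingHom`, `splitForm_det_ne_zero`, `isUnit_splitForm_det` (every `N`);
§1 `exists_isAutomorphicMeasure_splitForm` (every `N`), **`exists_isAutomorphicMeasure_qs₃`** (THE HEAD, A3 :102–:103 bytes), `exists_isAutomorphicMeasure_cmDatum_splitForm`;
§2 `isAutomorphicMeasure_splitForm_unique_smul`, `isAutomorphicMeasure_qs₃_unique_smul`; §3 bridges `isAutomorphicMeasure_cmDatum_of_adelicGroupData_splitForm`,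
`isAutomorphicMeasure_adelicGroupData_of_cmDatum_splitForm`, `isFiniteMeasure_of_isAutomorphicMeasure_qs₃`.
HONEST LABEL: an existence ★ pays no socket (it names the `μqs` pin for the later :254 payer); HC_CM is proved only modulo the 7 printed citations (2 remaining named inputs:
hLiu418 = `stmt-HodgeConjecture-24832`, h413 = `stmt-HodgeConjecture-24833`) until rung 0 closes; REL ≠ ★ ≠ BUILT; count-neutral.

## References
* [Borel1963] A. Borel, *Some finiteness properties of adele groups over number fields*, Publ. Math. IHÉS 16 (1963), §5, Thm. 5.8.
* [Rogawski1990] J. D. Rogawski, *Automorphic Representations of Unitary Groups in Three Variables*, Ann. of Math. Stud. 123 (1990), §1.9 (`Φ`), §12.1 p. 171 (`Φ₃`),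
  §13.6 (13.6.1) p. 208 (`L²(U(Φ₃)(L⁺)\U(Φ₃)(𝔸))`).
* [Mok2014] C. P. Mok, *Endoscopic classification of representations of quasi-split unitary groups*, Mem. AMS 235 (2015), §1 Notation p. 5 (`J_N`).
-/

set_option autoImplicit false
set_option linter.dupNamespace false

noncomputable section

open NumberField IsDedekindDomain MeasureTheory
open scoped Matrix NNReal

namespace Summit.HodgeConjecture.HodgeConjecture.R90.S5

open Literature.NumberTheory.Automorphic Literature.NumberTheory.Automorphic.UnitaryGroup
open Summit.HodgeConjecture.HodgeConjecture.Cruxes.H413.F0P3InnerFormClassificationV6 (splitForm)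

/-! ## §0 The two side facts of Borel's theorem for the anti-diagonal form `Φ_N = splitForm L N` (every `N`) -/

section SideFacts

variable (L : Type) [Field L] [NumberField L] [IsCMField L]

/-- **`ᵗ(c Φ_N) = Φ_N`** in the `hH` shape of ★ `exists_isAutomorphicMeasure_cmDatum_of_isHermitian`: `((splitForm L N).map (cmConjRingHom L))ᵀ = splitForm L N`
(the entries `0, 1` are fixed by the ring map `c`, and the pattern `i + j + 1 = N` is symmetric in `i, j`). [cite: Rogawski1990, §12.1 p. 171] [cite: Mok2014, §1 Notation p. 5] -/
theorem splitForm_map_cmConjRingHom_transpose (N : ℕ) : ((splitForm L N).map (cmConjRingHom L))ᵀ = splitForm L N := by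
  ext i j
  simp only [Matrix.transpose_apply, Matrix.map_apply, Matrix.of_apply]
  by_cases h : i.val + j.val + 1 = N
  · rw [if_pos (by omega), if_pos h, map_one]
  · rw [if_neg (by omega), if_neg h, map_zero]

/-- The same with transpose and conjugation in the other order: `(splitForm L N)ᵀ.map (cmConjRingHom L) = splitForm L N`. [cite: Rogawski1990, §12.1 p. 171] -/
theorem splitForm_transpose_map_cmConjRingHom (N : ℕ) : (splitForm L N)ᵀ.map (cmConjRingHom L) = splitForm L N := by
  ext i j
  simp only [Matrix.map_apply, Matrix.transpose_apply, Matrix.of_apply]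
  by_cases h : i.val + j.val + 1 = N
  · rw [if_pos (by omega), if_pos h, map_one]
  · rw [if_neg (by omega), if_neg h, map_zero]

omit [NumberField L] [IsCMField L] in
/-- **`det Φ_N` is a unit** (`Φ_N² = 1`): ★ `isUnit_det_antidiagonal_over` read through ★ `StdForm.over_antidiagonal_eq` (`(StdForm.antidiagonal N).over L` IS the literal body
of `splitForm L N`). [cite: Rogawski1990, §1.9] [cite: Mok2014, §1 Notation p. 5] -/
theorem isUnit_splitForm_det (N : ℕ) : IsUnit (splitForm L N).det := by
  have h := isUnit_det_antidiagonal_over L N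
  rw [StdForm.over_antidiagonal_eq] at h
  exact h

omit [NumberField L] [IsCMField L] in
/-- **`det Φ_N ≠ 0`** in the `hdet` shape of ★ `exists_isAutomorphicMeasure_cmDatum_of_isHermitian`. [cite: Rogawski1990, §1.9] -/
theorem splitForm_det_ne_zero (N : ℕ) : (splitForm L N).det ≠ 0 :=
  (isUnit_splitForm_det L N).ne_zero

end SideFacts

/-! ## §1 Existence of an automorphic measure on `U(Φ_N)(L⁺)\U(Φ_N)(𝔸_{L⁺})` at the `adelicGroupData … (splitForm L N)` spelling -/

section Existence

variable (L : Type) [Field L] [NumberField L] [IsCMField L]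

/-- **Automorphic measures on `U(Φ_N)(L⁺)\U(Φ_N)(𝔸_{L⁺})` exist, every `N`**, at the spelling `adelicGroupData L⁺ L c N (splitForm L N)`: finite, positive on non-empty
open sets, inner regular and `U(Φ_N)(𝔸_{L⁺})`-invariant (★ `exists_isAutomorphicMeasure_cmDatum_of_isHermitian` with §0, carried across ★ `adelicGroupData_eq_cmDatum`).
[cite: Borel1963, Thm. 5.8] [cite: Rogawski1990, §13.6 (13.6.1) p. 208] -/
theorem exists_isAutomorphicMeasure_splitForm (N : ℕ) :
    ∃ μqs : Measure (adelicGroupData (↥(maximalRealSubfield L)) L (IsCMField.complexConj L) N (splitForm L N)).automorphicQuotient,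
      (adelicGroupData (↥(maximalRealSubfield L)) L (IsCMField.complexConj L) N (splitForm L N)).IsAutomorphicMeasure μqs := by
  rw [adelicGroupData_eq_cmDatum]
  exact exists_isAutomorphicMeasure_cmDatum_of_isHermitian L N (splitForm L N) (splitForm_map_cmConjRingHom_transpose L N)
    (splitForm_det_ne_zero L N)

/-- **THE PIN — an automorphic measure `μqs` on `U(Φ₃)(L⁺)\U(Φ₃)(𝔸_{L⁺})` EXISTS**, with the measure TYPE of A3 `Lines/R90_S5_ArchJLettersA3.lean` :102–:103 token for token
(`Measure (adelicGroupData (↥(maximalRealSubfield L)) L (IsCMField.complexConj L) 3 (splitForm L 3)).automorphicQuotient` + `….IsAutomorphicMeasure μqs`): the `μqs` the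
Lines-side payer of `stub_R90_1336c_membership₃` (A :254) exhibits by name (`obtain ⟨μqs, hμqs⟩ := exists_isAutomorphicMeasure_qs₃ L; haveI := hμqs`).  Borel's finiteness
of the invariant volume of `G_k\G_A` for `G = U(Φ₃)` over `L⁺` (no rational characters). [cite: Borel1963, Thm. 5.8] [cite: Rogawski1990, §13.6 (13.6.1) p. 208] -/
theorem exists_isAutomorphicMeasure_qs₃ (L : Type) [Field L] [NumberField L] [IsCMField L] :
    ∃ μqs : Measure (adelicGroupData (↥(maximalRealSubfield L)) L (IsCMField.complexConj L) 3 (splitForm L 3)).automorphicQuotient,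
      (adelicGroupData (↥(maximalRealSubfield L)) L (IsCMField.complexConj L) 3 (splitForm L 3)).IsAutomorphicMeasure μqs :=
  exists_isAutomorphicMeasure_splitForm L 3

/-- The same existence at the `UnitaryGroup.cmDatum L N (splitForm L N)` spelling (the T1 ∕ E1 kit's datum), every `N`. [cite: Borel1963, Thm. 5.8] -/
theorem exists_isAutomorphicMeasure_cmDatum_splitForm (N : ℕ) :
    ∃ μqs : Measure (cmDatum L N (splitForm L N)).automorphicQuotient, (cmDatum L N (splitForm L N)).IsAutomorphicMeasure μqs :=
  exists_isAutomorphicMeasure_cmDatum_of_isHermitian L N (splitForm L N) (splitForm_map_cmConjRingHom_transpose L N) (splitForm_det_ne_zero L N)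

end Existence

/-! ## §2 Uniqueness up to a positive scalar at the A3 spelling -/

section Uniqueness

variable (L : Type) [Field L] [NumberField L] [IsCMField L]

/-- **Two automorphic measures on `U(Φ_N)(L⁺)\U(Φ_N)(𝔸_{L⁺})` differ by a positive scalar**, at the spelling `adelicGroupData L⁺ L c N (splitForm L N)` (★
`isAutomorphicMeasure_unique_smul_cmDatum`, instances carried across ★ `adelicGroupData_eq_cmDatum` by `haveI`). [cite: Borel1963, §5] -/
theorem isAutomorphicMeasure_splitForm_unique_smul (N : ℕ)
    (μ ν : Measure (adelicGroupData (↥(maximalRealSubfield L)) L (IsCMField.complexConj L) N (splitForm L N)).automorphicQuotient)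
    [hμ : (adelicGroupData (↥(maximalRealSubfield L)) L (IsCMField.complexConj L) N (splitForm L N)).IsAutomorphicMeasure μ]
    [hν : (adelicGroupData (↥(maximalRealSubfield L)) L (IsCMField.complexConj L) N (splitForm L N)).IsAutomorphicMeasure ν] :
    ∃ c : ℝ≥0, c ≠ 0 ∧ μ = c • ν := by
  haveI : (cmDatum L N (splitForm L N)).IsAutomorphicMeasure μ := hμ
  haveI : (cmDatum L N (splitForm L N)).IsAutomorphicMeasure ν := hν
  exact isAutomorphicMeasure_unique_smul_cmDatum L N (splitForm L N) μ ν

/-- **The pin is canonical up to `ℝ_{>0}`**: any two automorphic measures `μqs`, `μqs′` of the A3 type (`N = 3`) satisfy `μqs = c • μqs′` with `c ≠ 0`. [cite: Borel1963, §5] -/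
theorem isAutomorphicMeasure_qs₃_unique_smul
    (μ ν : Measure (adelicGroupData (↥(maximalRealSubfield L)) L (IsCMField.complexConj L) 3 (splitForm L 3)).automorphicQuotient)
    [(adelicGroupData (↥(maximalRealSubfield L)) L (IsCMField.complexConj L) 3 (splitForm L 3)).IsAutomorphicMeasure μ]
    [(adelicGroupData (↥(maximalRealSubfield L)) L (IsCMField.complexConj L) 3 (splitForm L 3)).IsAutomorphicMeasure ν] :
    ∃ c : ℝ≥0, c ≠ 0 ∧ μ = c • ν :=
  isAutomorphicMeasure_splitForm_unique_smul L 3 μ ν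

end Uniqueness

/-! ## §3 The `rfl`-bridges between the A3 spelling and the `cmDatum` spelling (instances do not cross `adelicGroupData_eq_cmDatum` by themselves) -/

section Bridges

variable (L : Type) [Field L] [NumberField L] [IsCMField L]

/-- **A3 spelling ⟹ `cmDatum` spelling**: an automorphic measure for `adelicGroupData L⁺ L c N (splitForm L N)` IS one for `UnitaryGroup.cmDatum L N (splitForm L N)`
(same term, ★ `adelicGroupData_eq_cmDatum` is `rfl`); use as `haveI := isAutomorphicMeasure_cmDatum_of_adelicGroupData_splitForm L N μ` before invoking ★ `cmDatum`-typed
theorems at the pin. [cite: Borel1963, §5] -/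
theorem isAutomorphicMeasure_cmDatum_of_adelicGroupData_splitForm (N : ℕ)
    (μ : Measure (adelicGroupData (↥(maximalRealSubfield L)) L (IsCMField.complexConj L) N (splitForm L N)).automorphicQuotient)
    [hμ : (adelicGroupData (↥(maximalRealSubfield L)) L (IsCMField.complexConj L) N (splitForm L N)).IsAutomorphicMeasure μ] :
    (cmDatum L N (splitForm L N)).IsAutomorphicMeasure μ :=
  hμ

/-- **`cmDatum` spelling ⟹ A3 spelling**: an automorphic measure for `UnitaryGroup.cmDatum L N (splitForm L N)` IS one for `adelicGroupData L⁺ L c N (splitForm L N)`.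
[cite: Borel1963, §5] -/
theorem isAutomorphicMeasure_adelicGroupData_of_cmDatum_splitForm (N : ℕ)
    (μ : Measure (cmDatum L N (splitForm L N)).automorphicQuotient) [hμ : (cmDatum L N (splitForm L N)).IsAutomorphicMeasure μ] :
    (adelicGroupData (↥(maximalRealSubfield L)) L (IsCMField.complexConj L) N (splitForm L N)).IsAutomorphicMeasure μ :=
  hμ

/-- **The pin is a finite measure** (first field of ★ `AdelicGroupData.IsAutomorphicMeasure`; recorded at the A3 type so that `μqs Set.univ < ∞` is available by name).
[cite: Borel1963, Thm. 5.8] -/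
theorem isFiniteMeasure_of_isAutomorphicMeasure_qs₃
    (μ : Measure (adelicGroupData (↥(maximalRealSubfield L)) L (IsCMField.complexConj L) 3 (splitForm L 3)).automorphicQuotient)
    [(adelicGroupData (↥(maximalRealSubfield L)) L (IsCMField.complexConj L) 3 (splitForm L 3)).IsAutomorphicMeasure μ] :
    IsFiniteMeasure μ :=
  inferInstance

end Bridges

end Summit.HodgeConjecture.HodgeConjecture.R90.S5

end
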